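import Summits.AtomisticToContinuum.Crystallization.Theorems.FrustratedLawDichotomySchurCutB

/-!
# FrustratedLawDichotomy · lens-5 g35 «AVERAGING CUT»: the Schur-cut residual `T′♭` localised to ONE coordination shell, its free
# allowance `C_T` ABSORBED, and the `C_T`-free, perfect-crystal-free core split by regime — for the residual OF RECORD `T′♭₄₅` (range 9/2,
# critic row 505) and its audited range-5 twin `T′♭₅`
# (decomp-a2c, lens-5 «finite/base range + asymptotic regime + bridge», generation 35 — RESIDUAL MODE D-0179; energetic feed of the crux
# `AperiodicFrustratedLawGap`, item stmt-AtomisticToContinuum-27623)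

State of record (critic rows 492/494/505/514, TREE GEN 34S): `FDG ⟸ SF ∧ UP ∧ T′♭ ∧ E′♭` (`…SchurCutB.fdg_of_split_schurCut_fourHalf/_five`),
with `SF₄₅`/`SF₅` KNOWN·CERTIFIED (census TAG 181-S(i), exact rationals), `UP` a tree number, `E′♭` ATTACKABLE-L, and the TOPOLOGICAL residual
`T′♭₄₅(C_T) = SchurTopologicalPricing (1/20) (1/8) w₄₅ ω₄ (3/400) (−7175/10000) (1/100) C_T` UNDECIDED · IDEA-NEEDED (row 505: residual of record =
shortest certified range; `T′♭₅` = the range-5 twin): `eUp·N + (1/100)·#{¬GoodAt(1/8)} − C_T·#{GoodAt(1/20)} ≤ Σ_{i<j} W(r_ij) − A·N` for every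
injective `7/10`-separated cluster, `W = effPot w ω A` of finite range `R` (`9/2`, resp. `5`).  Per site, with `h_j = ½Σ_{k≠j} W(r_jk)` and the
level `e = eUp + A` (`e₄₅ = −0.71`, `e₅ = −0.71425`) this is `Σ_j x_j(C_T) ≥ 0`, `x_j(C_T) = h_j − e − (1/100)·𝟙[¬GoodAt(1/8) j] + C_T·𝟙[GoodAt(1/20) j]`
(`surplus`, `xS`, `sum_surplus`).  Two features make `T′♭` awkward as a prover/instrument target: it is GLOBAL (a sum over an arbitrarily large
cluster) and it carries the FREE constant `C_T` coupling the perfect sites to everything else.  Radius-0 localisation («every `x_j ≥ 0`») is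
FALSE (MEASURED, §7): a 16-coordinated compressed core runs a sitewise deficit of `0.13`, and elastic give-and-take between neighbours plus the
`−1.1·10⁻³` offset of the perfect crystal below `e` make single strained sites run deficits up to `1.2·10⁻²`.  Hand-2's motif doors
(`…PairPotentialDoor`, `…MotifDoor(E)`, rows 505 (B)/514) type the ABSTRACT format «∃ local bounded finite-range transfer rule + a finite motif
certificate family»; this node supplies a CONCRETE rule, PROVES the regime that carries `C_T` away, and measures the radius.

## The lever: SENDER-NORMALISED BALL AVERAGING at radius `ρ` + TIGHT ABSORPTION (any admissible instance)

`S_i(ρ) := Σ_{j ∈ B(i,ρ)} x_j / #B(j,ρ)` (`ballAvg`; site `j` hands out `x_j` in equal shares to the sites of ITS OWN `ρ`-ball).  EXACT DOUBLE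
COUNT `Σ_i S_i = Σ_j x_j` (`sum_ballAvg`, the proportional instance of the zero-sum transfer format) ⟹ KERNEL `LAP_ρ ⟹ T′♭` for ANY Schur cut and
levels (`schurTopologicalPricing_of_ballAveraged`), where `LAP_ρ = BallAveragedPricing ρ …` := «every `S_i(ρ) ≥ 0`» reads only the `(ρ+R)`-cluster
of `i`.  REGIMES of a ball: (T) it contains a TIGHTLY good site (`GoodAt(1/20)`, `TightNear`); (F1) neither a tight nor a loosely bad site — a
purely STRAINED close-packed patch (`1/20 ≤ η < 1/8` everywhere); (F2) no tight site but a loosely BAD one (a defect core seen without any perfect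
crystal within `ρ`).  ADMISSIBLE INSTANCE `CutBounds W R B` (§3): `W ≥ −B` on `[0,∞)`, `W = 0` beyond `R` — PROVED for both literals
(`W₄₅_cutBounds : CutBounds W₄₅ (9/2) 1`, `W₅_cutBounds : CutBounds W₅ 5 (1/2)`, from `V_LJ ≥ −1/12`, `0 ≤ w ≤ 1`, `ω₂ ≤ 52`,
`effPot_fourHalf_eq_zero`/`effPot_five_eq_zero`).  TIGHT ABSORPTION (PROVED, `tightAbsorption_holds`): every surplus is `≥ −D(R,B,e)` (`xS_ge`,
packing `#B(j,R) ≤ Mball R = (20R/7+1)³`), a tight site carries `+C_T`, a `ρ`-ball has `≤ Mball ρ` sites — so for `C_T ≥ C_T⁰(R,B,e,ρ) =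
D·(1 + Mball ρ²)` EVERY (T)-ball has `S_i ≥ 0` whatever else it contains.  Hence the free constant disappears (§4 generic, §5 literal):

  `schurTopologicalPricing_of_tightFree : CutBounds (effPot w ω A) R B → 0 ≤ ρ → StrainedPatchPricing (effPot w ω A) (eUp+A) ρ →`
  `    TightFreeDefectPricing (effPot w ω A) (eUp+A) ρ → SchurTopologicalPricing (1/20) (1/8) w ω A eUp (1/100) (C_T⁰ R B (eUp+A) ρ)`  (PROVED),
  `schurTopologicalPricing_fourHalf_of_tightFree : 0 ≤ ρ → F1₄₅(ρ) → F2₄₅(ρ) → T′♭₄₅(C_T⁴⁵(ρ))`  (RECORD)   · `…_five_of_tightFree` (TWIN),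

and BY NAME (§6) `fdg_fourHalf_of_tightFree : SF₄₅ → UP → F1₄₅(ρ) → F2₄₅(ρ) → E′♭₄₅ → FDG`, `aperiodicFrustratedLawGap_fourHalf_of_tightFree :
MuEquilibriumDoor → SF₄₅ → UP → F1₄₅(ρ) → F2₄₅(ρ) → E′♭₄₅ → AperiodicFrustratedLawGap` (+ the `_five_` twins).  `FDG` tolerates any `C_T`
(`fdg_of_split_schurCut_*` is universal in `C_T`), so the crude `C_T⁰` costs nothing.

## Pieces (Target `T′♭₄₅`, twin `T′♭₅`; tags per D-0171; node kind: ONE EQUIV-or-STRONGER layer `LAP_ρ` with the regime split beneath)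

* `BallAveragedPricing ρ …` (LAP_ρ) — the layer: STRONGER-or-equal than `T′♭` (local ⟹ global by `sum_ballAvg`; the converse fails for every
  fixed `ρ`); its two ends are formal twins: radius `< 7/10` IS sitewise pricing (`ballAveragedPricing_iff_sitewise`, MEASURED FALSE) and radius
  `≥ diam` IS the global mean (`ballAvg_eq_mean_of_diam_le`, = the target on that cluster).  Evidence that ONE SHELL (`ρ = 1.15 = 1.18·d`) is
  already harmless: §MEASURED (every tested ball `S_i ≥ 0`, ≈ 1200 balls over both instances, 14 families).
* (T) `TightAbsorption W e ρ C_T` — COSTUME(trivial; PROVED for `C_T ≥ C_T⁰`, this file) — the piece that eliminates `C_T`.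
* (F1) `StrainedPatchPricing W e ρ` — WEAKER (regime-restricted and `C_T`-free: says nothing about defects, perfect crystal or `C_T`; must-fail
  probe `F1 → T′♭` in `bc/AveragingCut_probes.lean`) · TRUE-type-indicated (both instances: homogeneous hcp basal shear at `η = 1/20`:
  `S = x = +2.4·10⁻³` (= census TAG 181-S(ii) margin); Bain path `t = 0.05…0.10`: `+6.4·10⁻³ … +3.2·10⁻²`; random fields `σ = 0.012…0.02 d`:
  217 F1-balls, min `+6.4·10⁻³`) · ATTACKABLE-L (a finite-dimensional constrained minimum: the `W`-energy of a `(ρ+R)`-cluster of a Barlow stacking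
  under displacement fields with every cage misfit `≥ 1/20` — Taylor/Hessian of a finite-range pair sum; softest-mode margin = the stated test) ·
  INSTRUMENTABLE.
* (F2) `TightFreeDefectPricing W e ρ` — WEAKER (same probes) · UNDECIDED with stated test (adversarial basin-hopping over `7/10`-separated cores
  of `≤ 60` atoms EMBEDDED in a relaxed close-packed matrix, for a tight-free one-shell ball with `S_i(0) < 0`; none among ≈ 650 tight-free balls
  of 14 families incl. Mackay 309/923, A15, bcc, vacancy, interstitial-like displacement `0.12–0.14 d`, 16-coordinated compressed cores, random
  fields; min `+9.9·10⁻³` on structured defects) · IDEA-NEEDED (the `C_T`-free, perfect-crystal-free core of the lens-5 residual: «no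
  `7/10`-separated arrangement around a NON-close-packed site beats the close-packed energy density `e` of the Schur potential by more than the
  surplus its own coordination shell carries») · INSTRUMENTABLE.
* Both F-pieces at fixed `ρ` are statements about point sets of bounded cardinality (`≤ Mball(ρ+R+13/10·…)`) in a bounded ball, with `W` and
  `GoodAt` semi-algebraic (`W₄₅` is piecewise POLYNOMIAL·LAURENT: cubic smoothstep, `ω₂(5r/4)`) ⟹ each is ONE sentence of the first-order theory of
  `ℝ` (decidable in principle; interval branch-and-bound in practice) — the lens's «finite range» made literal: theorem first (this file),
  computation second (census); they are also motif certificates in hand-2's sense at radius `ϱ = ρ + R` (`…MotifCount.motif_card_le`).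

WHY EACH PIECE IS STRICTLY WEAKER / NOT A COSTUME.  (T) is proved.  (F1) and (F2) each restrict to ONE regime of ONE ball and drop `C_T`;
neither alone implies `T′♭` (the other regime is unconstrained — probes P1/P2), neither is implied by a landed theorem (P5–P7), and their
conjunction is the `C_T`-free localisation `LAP_ρ|_{tight-free}` whose radius-0 version is FALSE and whose radius-∞ version is the target — the
content of the node is the MEASURED fact that radius ONE SHELL suffices on every adversary tried, i.e. that the non-local part of `T′♭` is
nearest-neighbour give-and-take and nothing longer.  WHY NOVEL (relative to the column and to hand-2's `…LocalPricing` / `…LocalDischargingRule` /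
`…PairPotentialDoor` / `…MotifDoor(E)`, which type the abstract format `∃ F local bounded finite-range, certificate after F`): (i) a CONCRETE rule
(sender-normalised ball averaging) with a PROVED regime elimination — the tight regime and the constant `C_T` leave the residual altogether, which
no `∃ F`-format states; (ii) the residual is cut BENEATH `T′♭` into a near-crystal elastic piece and a defect-core piece that never see a perfect
site, both finite-dimensional; (iii) the dial `ρ` is measured (`0`: false by `0.13`; one shell: all pass), not posited; (iv) one generic theorem
serves every certified range (9/2 record, 5 twin, any future `SF_R`).

## MEASURED (HOME/decomp-a2c-lens-5/g35/scripts/avgcut.py [AVG_INSTANCE=45|5], overopt.py; pure python, each run ≤ 58 s; logs/)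

Classes by the tree's `GoodAt` (`d` = nearest-neighbour distance, exactly 12 sites below `1.3·d`, sup-misfit `η·d` after the best similarity onto
the fcc/hcp kissing pattern).  RECORD INSTANCE `W₄₅` (`A = 3/400`, `e₄₅ = −0.71`, `κ_T = 1/100`) [range-5 twin `W₅` in brackets, `e₅ = −0.71425`].
Sitewise surplus `x_j(0)`: fcc `−1.12·10⁻³` [`−1.08·10⁻³`], hcp `−1.24·10⁻³` [`−1.16·10⁻³`] (tight: the perfect crystal sits BELOW the level — hence
`C_T`; measured need `C_T ≥ 1.25·10⁻³`), hcp basal shear `3.66 %` (`η = 0.050`, strained) `+2.36·10⁻³` [`+2.44·10⁻³`] (= census S181(ii) @9/2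
`+2.360·10⁻³`), Bain path `t = 0.05/0.07/0.10/0.13`: `+6.4·10⁻³/+1.44·10⁻²/+3.22·10⁻²/+4.68·10⁻²` [same to `10⁻⁴`], bcc (14-coordinated, bad)
`+2.00·10⁻²`, A15 Z12 `+1.46·10⁻²` / Z14 `+9.56·10⁻²`, vacancy shell (11-coordinated) `+2.94·10⁻²`, Mackay icosahedron `K = 6` (923 atoms,
scale-relaxed): five-fold axes `+9.9·10⁻³` [`+1.01·10⁻²`] (the minimum over all structured defect probes), interior strained `≥ +1.43·10⁻²`,
zero deficit sites.  SITEWISE FAILURES (radius 0): (a) OVER-COORDINATED COMPRESSED CORES — a site with 16 neighbours at distance `1` (pairwise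
`≥ 7/10`, legal) and shells `31 @ 1.62`, `60 @ 2.45` has `x_j(any C_T) = −8.9·10⁻²` [`−1.32·10⁻¹`] (the site is bad; the repulsion `V_LJ(0.70) =
+4.6` among its neighbours is invisible to its own half-sum; `overopt.py`; 14 neighbours: `−1.0·10⁻³` [`+6.9·10⁻⁴`]); (b) ELASTIC give-and-take —
fcc + one atom displaced tangentially by `0.06/0.09/0.12 d`: strained neighbours `−2.5/−2.5/−2.0·10⁻³`; random iid Gaussian fields on fcc,
`σ = 0.012/0.015/0.02 d` (429 inner sites per run; 5 runs [9 runs]): min `x_j = −8.0/−8.7/−9.0·10⁻³` [`−0.9/−1.1/−1.2·10⁻²`], mean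
`+0.7/+1.2/+2.1·10⁻²`.  ONE SHELL (`ρ = 1.15`): compressed-core balls `+3.5 … +4.1` (the shell carries the repulsion); random fields — F1-balls
`n = 95` [`122`], min `S = +6.4·10⁻³` [`+6.5·10⁻³`]; F2-balls `n = 164` [`238`], min `+1.01·10⁻²` [`+1.0·10⁻²`]; T-balls AT `C_T = 0` `n = 136` [`351`],
min `+2.5·10⁻³` [`+2.3·10⁻³`]; displaced-atom balls min `+6.4·10⁻⁴` (T-ball at `C_T = 0`) … `+3.2·10⁻²`; every structured family unchanged in sign.
`ρ* =` ONE SHELL on all 14 families and both instances (≈ 1200 balls); no tested ball needs `ρ > 1.15`.  UNTESTED and the natural F2 adversary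
(census ASK): a polytetrahedral / anti-Mackay 45-atom core EMBEDDED in a relaxed close-packed matrix — its frustration cost sits in the third
shell, so `ρ*` may be 2–3 shells there; the node theorems are uniform in `ρ`.

## Dead variants (this generation)
Radius 0 (sitewise) — FALSE as above.  Periodic-cell ladder by atoms per cell as the split — the complement «n > n₀» is the whole residual
(capped ladder).  Cube superadditivity — inter-cube attraction is surface-order, `L ≳ 250 d`, no finite bridge.  Hard-core upgrade `7/10 → r_h` by
deletion — forfeits binding `≈ 1.4` per deleted site, no gain unless `r_h ≤ 0.75`.  Quasi-kissing rigidity as a piece («ε-regular neighbourhoods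
⟹ GoodAt») — false for `ε ≳ 0.05` at any fixed radius (Mackay interiors are strained/decahedral with locally regular shells).  Re-proving the
abstract discharging kernel — already landed (`…LocalPricing`, `…LocalDischargingRule`, `…PairPotentialDoor`); cited, not duplicated (this file
proves only the concrete proportional rule it needs, `sum_ballAvg`, and the packing count `card_ball_le`, cf. `…MotifCount.motif_card_le`).
-/

noncomputable section

namespace Summit.AtomisticToContinuum.Crystallization.Theorems.FrustratedLawDichotomyAveragingCut

open scoped BigOperators Classical
open Literature.MathematicalPhysics.StatisticalMechanics (interactionEnergy lennardJones siteEnergy two_mul_interactionEnergy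
  neg_one_div_le_lennardJones card_le_of_separated_of_dist_le)
open Summit.AtomisticToContinuum.Crystallization.Theorems.FrustratedLawDichotomyRangeCut
open Summit.AtomisticToContinuum.Crystallization.Theorems.FrustratedLawDichotomySchurCut

/-- `ℝ³`. -/
abbrev E3 := EuclideanSpace ℝ (Fin 3)

/-! ## §1. Site surplus, closed balls, ball averages, and the exact double count -/

/-- **Site surplus** `x_j = ½·Σ_{k ≠ j} W(r_jk) − e − κ_T·𝟙[¬GoodAt η₁ j] + C_T·𝟙[GoodAt η₀ j]` of site `j` for the finite-range pair
potential `W` at level `e` (for `T′♭₅`: `W = W₅ = effPot w₅ ω₅ (13/4000)`, `e = e_W = eUp + A = −0.7175 + 13/4000`, `κ_T = 1/100`). -/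
def surplus (η₀ η₁ : ℝ) (W : ℝ → ℝ) (e κT CT : ℝ) {N : ℕ} (y : Fin N → E3) (j : Fin N) : ℝ :=
  siteEnergy W y j / 2 - e - κT * (1 - (if GoodAt η₁ y j then (1 : ℝ) else 0)) + CT * (if GoodAt η₀ y j then (1 : ℝ) else 0)

/-- The closed `ρ`-ball of site `i` (as a set of site indices; contains `i`). -/
def ball (ρ : ℝ) {N : ℕ} (y : Fin N → E3) (i : Fin N) : Finset (Fin N) :=
  Finset.univ.filter (fun j : Fin N => dist (y j) (y i) ≤ ρ)

/-- **Ball average of a site functional** with the SENDER's mass as normaliser: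
`S_i = Σ_{j ∈ B(i,ρ)} x_j / #B(j,ρ)` — site `j` splits `x_j` equally among the sites of ITS OWN ball. -/
def ballAvg (ρ : ℝ) {N : ℕ} (y : Fin N → E3) (x : Fin N → ℝ) (i : Fin N) : ℝ :=
  ∑ j ∈ ball ρ y i, x j / ((ball ρ y j).card : ℝ)

/-- `mem_ball` (formal bookkeeping). [folklore] -/
theorem mem_ball {ρ : ℝ} {N : ℕ} {y : Fin N → E3} {i j : Fin N} : j ∈ ball ρ y i ↔ dist (y j) (y i) ≤ ρ := by
  simp [ball]

/-- `mem_ball_comm` (formal bookkeeping). [folklore] -/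
theorem mem_ball_comm {ρ : ℝ} {N : ℕ} {y : Fin N → E3} {i j : Fin N} : j ∈ ball ρ y i ↔ i ∈ ball ρ y j := by
  rw [mem_ball, mem_ball, dist_comm]

/-- `self_mem_ball` (formal bookkeeping). [folklore] -/
theorem self_mem_ball {ρ : ℝ} (hρ : 0 ≤ ρ) {N : ℕ} (y : Fin N → E3) (i : Fin N) : i ∈ ball ρ y i := by
  rw [mem_ball, dist_self]; exact hρ

/-- `one_le_card_ball` (formal bookkeeping). [folklore] -/
theorem one_le_card_ball {ρ : ℝ} (hρ : 0 ≤ ρ) {N : ℕ} (y : Fin N → E3) (i : Fin N) : 1 ≤ (ball ρ y i).card :=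
  Finset.card_pos.mpr ⟨i, self_mem_ball hρ y i⟩

/-- `card_ball_pos` (formal bookkeeping). [folklore] -/
theorem card_ball_pos {ρ : ℝ} (hρ : 0 ≤ ρ) {N : ℕ} (y : Fin N → E3) (i : Fin N) : (0 : ℝ) < (ball ρ y i).card :=
  Nat.cast_pos.mpr (one_le_card_ball hρ y i)

/-- **Packing**: under the hard core `7/10`, a `ρ`-ball holds at most `(20ρ/7 + 1)³` sites. [folklore] -/
theorem card_ball_le {ρ : ℝ} (hρ : 0 ≤ ρ) {N : ℕ} {y : Fin N → E3} (hs : Sep y) (i : Fin N) :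
    ((ball ρ y i).card : ℝ) ≤ (2 * ρ / (7 / 10) + 1) ^ 3 := by
  have hinj : Function.Injective y := fun a b hab => by
    by_contra hne
    have h1 := hs a b hne
    rw [hab, dist_self] at h1
    linarith
  have h := card_le_of_separated_of_dist_le ((ball ρ y i).image y) (y i) (by norm_num : (0 : ℝ) < 7 / 10) hρ ?_ ?_
  · rw [finrank_euclideanSpace_fin, Finset.card_image_of_injective _ hinj] at h
    exact_mod_cast h
  · intro p hp
    obtain ⟨j, hj, rfl⟩ := Finset.mem_image.1 hp
    exact mem_ball.1 hj
  · intro p hp q hq hpq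
    obtain ⟨j, -, rfl⟩ := Finset.mem_image.1 hp
    obtain ⟨k, -, rfl⟩ := Finset.mem_image.1 hq
    exact hs j k (fun hjk => hpq (hjk ▸ rfl))

/-- **EXACT DOUBLE COUNT** (the bridge of the node): `Σ_i S_i = Σ_j x_j` — every site's surplus is fully redistributed, nothing is
created or lost (a zero-sum transfer in the format of `…LocalPricing.sum_le_sum_of_transfers`, here the PROPORTIONAL rule). [folklore] -/
theorem sum_ballAvg {ρ : ℝ} (hρ : 0 ≤ ρ) {N : ℕ} (y : Fin N → E3) (x : Fin N → ℝ) :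
    ∑ i, ballAvg ρ y x i = ∑ j, x j := by
  unfold ballAvg
  simp only [ball, Finset.sum_filter]
  rw [Finset.sum_comm]
  refine Finset.sum_congr rfl fun j _ => ?_
  rw [← Finset.sum_filter]
  have hset : Finset.univ.filter (fun i : Fin N => dist (y j) (y i) ≤ ρ) = Finset.univ.filter (fun k : Fin N => dist (y k) (y j) ≤ ρ) := by
    ext k; simp [dist_comm]
  rw [hset, Finset.sum_const, nsmul_eq_mul]
  have hpos : (0 : ℝ) < (Finset.univ.filter (fun k : Fin N => dist (y k) (y j) ≤ ρ)).card := card_ball_pos hρ y j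
  field_simp

/-- `goodCount` as a sum of indicators (as reals). [folklore] -/
theorem goodCount_eq_sum' (η : ℝ) {N : ℕ} (y : Fin N → E3) :
    (goodCount η y : ℝ) = ∑ i, (if GoodAt η y i then (1 : ℝ) else 0) := by
  rw [Finset.sum_boole, goodCount, Nat.card_eq_fintype_card, Fintype.card_subtype]

/-- `Σ_j x_j = (U_W − (e − … )·N …)`: the sum of the surpluses in closed form. [folklore] -/
theorem sum_surplus (η₀ η₁ : ℝ) (W : ℝ → ℝ) (e κT CT : ℝ) {N : ℕ} (y : Fin N → E3) :
    ∑ j, surplus η₀ η₁ W e κT CT y j =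
      interactionEnergy W y - e * N - κT * (N - goodCount η₁ y) + CT * goodCount η₀ y := by
  unfold surplus
  simp only [Finset.sum_add_distrib, Finset.sum_sub_distrib, Finset.sum_const, Finset.card_univ, Fintype.card_fin, nsmul_eq_mul,
    ← Finset.mul_sum, ← Finset.sum_div, goodCount_eq_sum', ← two_mul_interactionEnergy]
  ring

/-! ## §2. BALL-AVERAGED PRICING `LAP_ρ` and the kernel `LAP_ρ ⟹ T′♭` (any Schur cut) -/

/-- **`BallAveragedPricing ρ η₀ η₁ W e κ_T C_T` — LOCALLY AVERAGED PRICING at radius `ρ`**: in every injective `7/10`-separated finite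
cluster and at EVERY site `i`, the ball average `S_i = Σ_{j ∈ B(i,ρ)} x_j/#B(j,ρ)` of the surpluses is `≥ 0`.  A STRENGTHENING of the global
inequality `Σ_j x_j ≥ 0` (= `T′♭` for `W = effPot w ω A`, `e = eUp + A`), LOCAL: `S_i` reads only the atoms within `ρ + R` of `y i`
(`R` = range of `W`).  Tag: EQUIV-layer node (stronger-or-equal; the split is beneath it, §4). -/
def BallAveragedPricing (ρ η₀ η₁ : ℝ) (W : ℝ → ℝ) (e κT CT : ℝ) : Prop :=
  ∀ (N : ℕ) (y : Fin N → E3), Function.Injective y → Sep y → ∀ i : Fin N, 0 ≤ ballAvg ρ y (surplus η₀ η₁ W e κT CT y) i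

/-- **KERNEL `LAP_ρ ⟹ SchurTopologicalPricing`** (any cut `w, ω, A`, any levels): sum the ball averages, double count. PROVED. [folklore] -/
theorem schurTopologicalPricing_of_ballAveraged {ρ η₀ η₁ A eUp κT CT : ℝ} {w ω : ℝ → ℝ} (hρ : 0 ≤ ρ)
    (h : BallAveragedPricing ρ η₀ η₁ (effPot w ω A) (eUp + A) κT CT) : SchurTopologicalPricing η₀ η₁ w ω A eUp κT CT := by
  intro N y hy hs
  have hsum : 0 ≤ ∑ i, ballAvg ρ y (surplus η₀ η₁ (effPot w ω A) (eUp + A) κT CT y) i :=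
    Finset.sum_nonneg fun i _ => h N y hy hs i
  rw [sum_ballAvg hρ, sum_surplus] at hsum
  linarith

-- landing note (hand-2 g12): lens-5 g35 90945e53 (650 l) PRE-SPLIT for the 400-line rule: §3 in `…AveragingCutB`, §4–§7 in `…AveragingCutC` (byte-identical, same namespace).
end Summit.AtomisticToContinuum.Crystallization.Theorems.FrustratedLawDichotomyAveragingCut
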